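import Literature.GroupTheory.FiniteAbelian.CharacterModuleUnitAddCircle
import Mathlib.Topology.Instances.AddCircle.Defs
import Mathlib.GroupTheory.Index
import HarnessLib

/-!
# A finite abelian group with a `ℚ/ℤ`-pairing: `#T ∣ (#Z · ∏ ord xᵢ)²` when the characters of the `xᵢ`
# separate a coisotropic subgroup `L` modulo `Z` (the counting step of McCallum 1991, Thm. 5.4)

Topic `GroupTheory/FiniteAbelian`; namespace `Literature.GroupTheory.FiniteAbelian`. THEOREMS ONLY (no definition,
no named fact, no instance).

This is the pure counting skeleton of the UPPER-BOUND half of Kolyvagin's structure theorem for `Ш(E/K)[p^∞]` in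
McCallum's presentation [McCallumLMS1991, §5, proof of Thm. 5.4, pp. 312–314]: there `T = Ш(E/K)[p^∞]` (finite, with
the nondegenerate alternating Cassels–Tate pairing), `L = D = D₁ × D₂ × ⋯` a maximal isotropic subgroup, and the
Kolyvagin classes `xᵢ = d_{M_{i-1}}(nᵢ)` have Cassels–Tate characters forming a "triangular basis" of `D^*`, whence
`p^{Nᵢ} ≤ ord xᵢ ≤ p^{M_{i-1} − M_i}` and `#Ш = #D² ≤ p^{2 Σ (M_{i-1} − M_i)} ≤ p^{2M₀}`.  The skeleton is SIGN-FREE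
and prime-free — no `±`-eigenspaces of complex conjugation, no `p ≠ 2` — which is the form needed at `p = 2`
(route `GenusKolyvaginAtTwo`, crux `ShaCardDvdPowAtTwoRT`), and it carries a DEFECT subgroup `Z ≤ L` (separation only
modulo `Z`) so that a lossy separation still yields a bound:

* `natCard_torsionBy_ratAddCircle` — the `n`-torsion of `ℚ/ℤ = AddCircle (1 : ℚ)` has exactly `n` elements (`n ≥ 1`);
* `natCard_dvd_mul_prod_addOrderOf_of_separating` — for ANY bi-additive `B : T × T → ℚ/ℤ` on a finite abelian group,
  subgroups `Z ≤ L` and finitely many `xᵢ ∈ T` such that every `s ∈ L` with `B(xᵢ, s) = 0` for all `i` lies in `Z`: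
  `#L ∣ #Z · ∏ᵢ ord(xᵢ)` (the map `s ↦ (B(xᵢ, s))ᵢ` has kernel inside `Z` and image inside `∏ᵢ (ℚ/ℤ)[ord xᵢ]`);
* `natCard_dvd_sq_natCard_of_orthogonal_le` — if `L ⊇ L^⊥` (every `t` with `B(t, L) = 0` lies in `L`; e.g. a maximal
  isotropic subgroup of a nondegenerate alternating pairing) then `#T ∣ (#L)²` (the map `t ↦ B(t, ·)|_L` has kernel
  `L^⊥ ⊆ L` and image inside `Hom(L, ℚ/ℤ) ≅ L`);
* `natCard_dvd_sq_of_separating` — together: **`#T ∣ (#Z · ∏ᵢ ord xᵢ)²`**.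

References: [McCallumLMS1991] W. G. McCallum, *Kolyvagin's work on Shafarevich–Tate groups*, LMS LNS 153 (1991), §5
(proof of Thm. 5.4; Prop. 5.7); [Wall1963QuadraticFormsFiniteGroups] Lemma 7; [Serre1973] Ch. VI §1.1 (characters of a
finite abelian group); [Brown1982] Ch. III §4 (`ℚ/ℤ ⊇ (1/n)ℤ/ℤ ≈ ℤ/n`).
-/

noncomputable section

open AddSubgroup

namespace Literature.GroupTheory.FiniteAbelian

universe u

/-! ## §1 The `n`-torsion of `ℚ/ℤ` -/

/-- **The `n`-torsion of `ℚ/ℤ = AddCircle (1 : ℚ)` has exactly `n` elements** (`n ≥ 1`): it contains `1/n`, of order `n`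
(`AddCircle.addOrderOf_period_div`), and every `u` with `n • u = 0` is `m/n` for some `m < n` (`AddCircle.nsmul_eq_zero_iff`):
Brown, proof of III.(4.3), «`ℚ/ℤ` contains `(1/n)ℤ/ℤ ≈ ℤ/nℤ` for every `n ≠ 0`» — and that is all of the `n`-torsion.
[cite: Brown1982, Chap. III §4 (proof of Prop. 4.3)] [cite: Serre1973, Chap. VI §1.1] -/
theorem natCard_torsionBy_ratAddCircle {n : ℕ} (hn : 0 < n) :
    Nat.card (torsionBy (AddCircle (1 : ℚ)) (n : ℤ)) = n := by
  have hmem : ∀ u : AddCircle (1 : ℚ), u ∈ torsionBy (AddCircle (1 : ℚ)) (n : ℤ) ↔ n • u = 0 := fun u ↦ by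
    rw [torsionBy.nsmul_iff]
  -- the surjection `Fin n → (ℚ/ℤ)[n]`, `m ↦ m/n`
  let f : Fin n → torsionBy (AddCircle (1 : ℚ)) (n : ℤ) := fun m ↦
    ⟨(((m : ℕ) : ℚ) / (n : ℚ) * 1 : ℚ), (hmem _).mpr ((AddCircle.nsmul_eq_zero_iff hn).mpr ⟨m, m.2, rfl⟩)⟩
  have hf : Function.Surjective f := by
    rintro ⟨u, hu⟩
    obtain ⟨m, hm, hmu⟩ := (AddCircle.nsmul_eq_zero_iff hn).mp ((hmem u).mp hu)
    exact ⟨⟨m, hm⟩, Subtype.ext hmu⟩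
  haveI : Finite (torsionBy (AddCircle (1 : ℚ)) (n : ℤ)) := Finite.of_surjective f hf
  have hle : Nat.card (torsionBy (AddCircle (1 : ℚ)) (n : ℤ)) ≤ n := by
    simpa using Nat.card_le_card_of_surjective f hf
  -- `⟨1/n⟩` has order `n`
  set u : AddCircle (1 : ℚ) := (((1 : ℚ) / n : ℚ) : AddCircle (1 : ℚ)) with hu
  have hord : addOrderOf u = n := AddCircle.addOrderOf_period_div hn
  have hun : n • u = 0 := by
    have h := addOrderOf_nsmul_eq_zero u
    rwa [hord] at h
  have hsub : zmultiples u ≤ torsionBy (AddCircle (1 : ℚ)) (n : ℤ) :=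
    AddSubgroup.zmultiples_le_of_mem ((hmem u).mpr hun)
  have hge : n ≤ Nat.card (torsionBy (AddCircle (1 : ℚ)) (n : ℤ)) :=
    calc n = addOrderOf u := hord.symm
      _ = Nat.card (zmultiples u) := (Nat.card_zmultiples u).symm
      _ ≤ Nat.card (torsionBy (AddCircle (1 : ℚ)) (n : ℤ)) := card_le_of_le hsub
  exact le_antisymm hle hge

/-! ## §2 Separation modulo `Z` bounds `#L` -/

section Separation

variable {T : Type u} [AddCommGroup T]

/-- `ord(x) • B(x, s) = 0`: the values `B(x, ·)` lie in the `ord(x)`-torsion. [folklore] -/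
private theorem addOrderOf_nsmul_apply_apply_eq_zero {Q : Type*} [AddCommGroup Q] (B : T →+ T →+ Q) (x s : T) :
    addOrderOf x • B x s = 0 := by
  rw [← AddMonoidHom.nsmul_apply, ← map_nsmul, addOrderOf_nsmul_eq_zero, map_zero, AddMonoidHom.zero_apply]

/-- **Separation modulo `Z` bounds the order of `L`.**  `T` a finite abelian group, `B : T × T → ℚ/ℤ` bi-additive,
`Z ≤ L` subgroups, `x₁, …, x_r ∈ T`; if every `s ∈ L` with `B(xᵢ, s) = 0` for all `i` lies in `Z`, then
`#L ∣ #Z · ∏ᵢ ord(xᵢ)`.  Proof: `s ↦ (B(xᵢ, s))ᵢ` maps `L` into `∏ᵢ (ℚ/ℤ)[ord xᵢ]` (a group of order `∏ ord xᵢ`, §1) with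
kernel inside `Z`.  (McCallum: the Cassels–Tate characters of the Kolyvagin classes form a triangular basis of `D^*`,
`Z = 0`.) [cite: McCallumLMS1991, §5, proof of Thm. 5.4] -/
theorem natCard_dvd_mul_prod_addOrderOf_of_separating [Finite T] (B : T →+ T →+ AddCircle (1 : ℚ))
    (L Z : AddSubgroup T) (hZL : Z ≤ L) {ι : Type*} [Fintype ι] (x : ι → T)
    (hsep : ∀ s ∈ L, (∀ i, B (x i) s = 0) → s ∈ Z) :
    Nat.card L ∣ Nat.card Z * ∏ i, addOrderOf (x i) := by
  classical
  -- the target groups `(ℚ/ℤ)[ord xᵢ]`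
  have hpos : ∀ i, 0 < addOrderOf (x i) := fun i ↦ (isOfFinAddOrder_of_finite (x i)).addOrderOf_pos
  let S : ι → AddSubgroup (AddCircle (1 : ℚ)) := fun i ↦ torsionBy (AddCircle (1 : ℚ)) (addOrderOf (x i) : ℤ)
  have hcardS : ∀ i, Nat.card (S i) = addOrderOf (x i) := fun i ↦ natCard_torsionBy_ratAddCircle (hpos i)
  haveI : ∀ i, Finite (S i) := fun i ↦ Nat.finite_of_card_ne_zero (by rw [hcardS i]; exact (hpos i).ne')
  have hmemS : ∀ i (s : L), B (x i) (s : T) ∈ S i := fun i s ↦ by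
    change (addOrderOf (x i) : ℤ) • B (x i) (s : T) = 0
    rw [natCast_zsmul]
    exact addOrderOf_nsmul_apply_apply_eq_zero B (x i) s
  -- the map `φ : L → ∏ᵢ (ℚ/ℤ)[ord xᵢ]`
  let φ : L →+ (Π i, S i) :=
    AddMonoidHom.pi fun i ↦ (((B (x i)).comp L.subtype).codRestrict (S i) (hmemS i))
  have hφ : ∀ (s : L) i, ((φ s i : S i) : AddCircle (1 : ℚ)) = B (x i) (s : T) := fun _ _ ↦ rfl
  -- kernel inside `Z`
  have hker : φ.ker ≤ Z.addSubgroupOf L := by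
    intro s hs
    rw [AddMonoidHom.mem_ker] at hs
    rw [mem_addSubgroupOf]
    refine hsep s s.2 fun i ↦ ?_
    rw [← hφ s i, hs]
    rfl
  -- count
  have h1 : Nat.card L = Nat.card (L ⧸ φ.ker) * Nat.card φ.ker := card_eq_card_quotient_mul_card_addSubgroup _
  have h2 : Nat.card (L ⧸ φ.ker) = Nat.card φ.range := Nat.card_congr (QuotientAddGroup.quotientKerEquivRange φ).toEquiv
  have h3 : Nat.card φ.range ∣ ∏ i, addOrderOf (x i) := by
    have h := card_addSubgroup_dvd_card φ.range
    rw [Nat.card_pi] at h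
    simpa only [hcardS] using h
  have h4 : Nat.card φ.ker ∣ Nat.card Z := by
    have h := card_dvd_of_le hker
    rwa [Nat.card_congr (addSubgroupOfEquivOfLe hZL).toEquiv] at h
  rw [h1, h2, mul_comm]
  exact mul_dvd_mul h4 h3

/-! ## §3 A subgroup containing its own orthogonal has `#T ∣ (#L)²` -/

/-- **`L ⊇ L^⊥` implies `#T ∣ (#L)²`** for a bi-additive `B : T × T → ℚ/ℤ` on a finite abelian group `T`: the map
`t ↦ B(t, ·)|_L` has kernel `L^⊥ ⊆ L` and image in `Hom(L, ℚ/ℤ) ≅ L`.  (For a maximal isotropic subgroup of a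
nondegenerate alternating pairing, `L = L^⊥` and `#T = (#L)²`: McCallum's "the elementary divisors of `Ш(E/K)` come in
pairs", Wall 1963 Lemma 7.) [cite: McCallumLMS1991, §5 (p. 307)] [cite: Wall1963QuadraticFormsFiniteGroups, Lemma 7] -/
theorem natCard_dvd_sq_natCard_of_orthogonal_le [Finite T] (B : T →+ T →+ AddCircle (1 : ℚ)) (L : AddSubgroup T)
    (hL : ∀ t : T, (∀ s ∈ L, B t s = 0) → t ∈ L) :
    Nat.card T ∣ Nat.card L ^ 2 := by
  classical
  let Φ : T →+ (L →+ AddCircle (1 : ℚ)) := (AddMonoidHom.compHom' L.subtype).comp B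
  have hΦ : ∀ (t : T) (s : L), Φ t s = B t (s : T) := fun _ _ ↦ rfl
  obtain ⟨e⟩ := nonempty_addMonoidHom_ratAddCircle_addEquiv L
  haveI : Finite (L →+ AddCircle (1 : ℚ)) := Finite.of_equiv _ e.toEquiv.symm
  have hker : Φ.ker ≤ L := by
    intro t ht
    rw [AddMonoidHom.mem_ker] at ht
    refine hL t fun s hs ↦ ?_
    rw [← hΦ t ⟨s, hs⟩, ht, AddMonoidHom.zero_apply]
  have h1 : Nat.card T = Nat.card (T ⧸ Φ.ker) * Nat.card Φ.ker := card_eq_card_quotient_mul_card_addSubgroup _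
  have h2 : Nat.card (T ⧸ Φ.ker) = Nat.card Φ.range := Nat.card_congr (QuotientAddGroup.quotientKerEquivRange Φ).toEquiv
  have h3 : Nat.card Φ.range ∣ Nat.card L := by
    have h := card_addSubgroup_dvd_card Φ.range
    rwa [Nat.card_congr e.toEquiv] at h
  have h4 : Nat.card Φ.ker ∣ Nat.card L := card_dvd_of_le hker
  rw [h1, h2, sq]
  exact mul_dvd_mul h3 h4

/-! ## §4 The counting step of McCallum's Theorem 5.4, sign-free -/

/-- **The counting step of Kolyvagin's structure theorem (McCallum 1991, Thm. 5.4), sign-free and prime-free.**  Let `T`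
be a finite abelian group with a bi-additive `B : T × T → ℚ/ℤ`, `L` a subgroup containing its own orthogonal
(`B(t, L) = 0 ⟹ t ∈ L`; e.g. a maximal isotropic subgroup of the Cassels–Tate pairing on a finite `Ш(E/K)[p^∞]`),
`Z ≤ L` a defect subgroup, and `x₁, …, x_r ∈ T` whose characters `B(xᵢ, ·)` separate `L` modulo `Z`.  Then
**`#T ∣ (#Z · ∏ᵢ ord xᵢ)²`**.  With `Z = 0`, `T = Ш(E/K)[p^∞]` and McCallum's chain `xᵢ = d_{M_{i-1}}(nᵢ)` of orders
`≤ p^{M_{i-1} − M_i}` this is `#Ш(E/K)[p^∞] ∣ p^{2(M₀ − M_r)}`. [cite: McCallumLMS1991, §5, proof of Thm. 5.4 and Prop. 5.7] -/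
theorem natCard_dvd_sq_of_separating [Finite T] (B : T →+ T →+ AddCircle (1 : ℚ)) (L Z : AddSubgroup T) (hZL : Z ≤ L)
    (hL : ∀ t : T, (∀ s ∈ L, B t s = 0) → t ∈ L) {ι : Type*} [Fintype ι] (x : ι → T)
    (hsep : ∀ s ∈ L, (∀ i, B (x i) s = 0) → s ∈ Z) :
    Nat.card T ∣ (Nat.card Z * ∏ i, addOrderOf (x i)) ^ 2 :=
  (natCard_dvd_sq_natCard_of_orthogonal_le B L hL).trans
    (pow_dvd_pow_of_dvd (natCard_dvd_mul_prod_addOrderOf_of_separating B L Z hZL x hsep) 2)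

/-- **Corollary (prime-power form).**  In the situation of `natCard_dvd_sq_of_separating`, if `#Z · ∏ᵢ ord xᵢ ∣ p^m` then
`#T ∣ p^{2m}` — the shape of Kolyvagin's bound `#Ш(E/K)[p^∞] ∣ p^{2M₀}`. [cite: McCallumLMS1991, §1 Theorem, §5 Cor. 5.6] -/
theorem natCard_dvd_pow_two_mul_of_separating [Finite T] (B : T →+ T →+ AddCircle (1 : ℚ)) (L Z : AddSubgroup T)
    (hZL : Z ≤ L) (hL : ∀ t : T, (∀ s ∈ L, B t s = 0) → t ∈ L) {ι : Type*} [Fintype ι] (x : ι → T)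
    (hsep : ∀ s ∈ L, (∀ i, B (x i) s = 0) → s ∈ Z) {p m : ℕ} (hm : Nat.card Z * ∏ i, addOrderOf (x i) ∣ p ^ m) :
    Nat.card T ∣ p ^ (2 * m) := by
  rw [mul_comm, pow_mul]
  exact (natCard_dvd_sq_of_separating B L Z hZL hL x hsep).trans (pow_dvd_pow_of_dvd hm 2)

end Separation

end Literature.GroupTheory.FiniteAbelian

end
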